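import Summits.CriticalPhenomena.PercolationContinuityZ3.Theorems.PercNearOneGluingAdditiveGluingTBlockClasses
import HarnessLib

/-! # Crux `PercNearOneGluing.AdditiveGluing` (stmt-CriticalPhenomena-4576) — the FINGER class of the T-form (V⁺) recursion, reduced to ONE
# inequality (depth prover `png-dp-vplus`, seat (b) V⁺-form)

Support file (`--supports stmt-CriticalPhenomena-4576`); no definitions, no named facts; the open inequality enters as a HYPOTHESIS (`hFML3`).

An observer `o ∉ A` whose non-relay neighbours are FINGERS (each finger `x` has positive-weight pairs only to `o` and to relays) is the first
class of the T-form recursion with a COST (Kozma–Nitzan Thm 5 = one finger is cost-free: `additiveGluing_block_of_oneFree`): the glued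
finger blocks `N ⊆ {fingers}` are entered with the Question-9 designation `e` of `o` (the minimiser of the star-killed two-point function
`τ_{q_∅}`), which need not be minimal for the glued block.  Here we prove (`additiveGluing_fingers_of_FML3`) that the `AdditiveGluing`
inequality for every such observer follows from the **finger multi-edge Lemma 3**

  (FML3)  `K` a weighting, `A ∋ b`, `N` a non-empty block disjoint from `A` all of whose positive-weight pairs go to `A` (or stay inside `N`),
          `d ∈ A` with `μ_K(d ↔ b) ≤ μ_K(a ↔ b)` for all `a ∈ A` (the block UNGLUED).  Then, with `R` = "some pair `N–A` open",
          `μ_{K/N}(R ∩ {d ↔ b}) ≤ μ_{K/N}(R ∩ {N ↔ b})`,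

the `|N| = 1` case of which is the landed `multiEdge_lemma3_relays`.  Numerically FML3 has no counterexample (depth-prover memo HANDOFF.md §2:
15 500 random finger pairs, annealing, equivalent exchange form (♠)); it is the exact content of the first reversal cost of V⁺.
Proof of the reduction: `T_block_certificate` at `S = {o}` (`u/{o} = u`); a relay-free layer `N` of positive mass consists of fingers; for it
`T_e^{q_N}(N) ≥ μ_{q_N}(Rᶜ) + μ_{q_N}(R ∩ {N↔b}) − μ_{q_N}(R ∩ {e↔b}) − μ_{q_N}(Rᶜ) ≥ 0` by FML3 applied to `K = q_∅` (the star of `o` killed; there a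
finger's pairs all go to `A`), using that off `R` the finger block cannot reach `A` (a walk from `N` to `A` leaves `N` through an open pair, which off
`R` has weight `0`: `SimpleGraph.Walk.exists_boundary_dart` + `sigmaRec_null`).
[cite: KozmaNitzan2024, §3.2 (Lemma 5 p. 13, Thms 4–5 pp. 12–14), Lemma 3(i) (pp. 6–7), Question 9 (p. 36)]
-/

namespace Summit.CriticalPhenomena.PercolationContinuityZ3.Theorems

open MeasureTheory Set
open Literature.Probability.LatticeModels (prodBernoulli)
open Literature.Probability.Percolation (BondConfig openConn openGraph)
open scoped BigOperators Classical

noncomputable section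

section TFingers

open Literature.Probability.Percolation

variable {n : ℕ}

/-- **Off the contact event a block with relay-only pairs cannot reach the relays.**  If every positive-weight pair at the block `N`
(`Disjoint N A`) goes to `A` or stays inside `N`, then `μ_p((no N–A pair open) ∩ {N ↔ A}) = 0`: a walk from `N` to `A` leaves `N` through an
open pair `s(v, y)`, `v ∈ N`, `y ∉ N`; off the contact event `y ∉ A`, so that pair has weight `0`.
[folklore; `SimpleGraph.Walk.exists_boundary_dart`] -/
theorem finger_noContact_reach_null (p : Sym2 (Fin n) → unitInterval) (A N : Finset (Fin n)) (hNA : Disjoint N A)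
    (hfree : ∀ v ∈ N, ∀ y : Fin n, y ∉ A → y ∉ N → (p s(v, y) : ℝ) = 0) :
    (prodBernoulli p).real
        ({ω : Set (Sym2 (Fin n)) | ∃ v ∈ N, ∃ a ∈ A, s(v, a) ∈ ω}ᶜ ∩ ⋃ v ∈ N, ⋃ a ∈ A, openConn v a) = 0 := by
  refine sigmaRec_null p _
    ((N ×ˢ (Finset.univ.filter fun y : Fin n => y ∉ A ∧ y ∉ N)).image fun vy => s(vy.1, vy.2)) ?_ ?_
  · intro e he
    obtain ⟨⟨v, y⟩, hvy, rfl⟩ := Finset.mem_image.1 he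
    obtain ⟨hv, hy⟩ := Finset.mem_product.1 hvy
    obtain ⟨hyA, hyN⟩ := (Finset.mem_filter.1 hy).2
    exact Subtype.ext (by exact_mod_cast hfree v hv y hyA hyN)
  · rintro ω ⟨hR, hω⟩
    obtain ⟨v, hv, a, ha, hva⟩ : ∃ v ∈ N, ∃ a ∈ A, ω ∈ openConn v a := by
      simpa only [Set.mem_iUnion, exists_prop] using hω
    obtain ⟨w⟩ := hva
    have haN : a ∉ (↑N : Set (Fin n)) := fun h => Finset.disjoint_left.1 hNA (Finset.mem_coe.1 h) ha
    obtain ⟨dd, -, hfst, hsnd⟩ := w.exists_boundary_dart (↑N : Set (Fin n)) (Finset.mem_coe.2 hv) haN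
    have hadj := (openGraph_adj ω dd.fst dd.snd).1 dd.adj
    have hsndA : dd.snd ∉ A := by
      intro h
      exact hR ⟨dd.fst, Finset.mem_coe.1 hfst, dd.snd, h, hadj.1⟩
    refine ⟨s(dd.fst, dd.snd), Finset.mem_image.2 ⟨(dd.fst, dd.snd), ?_, rfl⟩, hadj.1⟩
    exact Finset.mem_product.2 ⟨Finset.mem_coe.1 hfst,
      Finset.mem_filter.2 ⟨Finset.mem_univ _, hsndA, fun h => hsnd (Finset.mem_coe.2 h)⟩⟩

/-- **A finger block's T-functional is non-negative whenever FML3's conclusion holds for it.**  `Disjoint N A`, `b ∈ A`, every positive-weight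
pair at `N` goes to `A` or stays inside `N` (in the weighting `p`); if `μ_{p/N}(R ∩ {d ↔ b}) ≤ μ_{p/N}(R ∩ {N ↔ b})` (`R` = some `N–A` pair open),
then `μ_{p/N}(N ↮ A) + μ_{p/N}(N ↔ b) − μ_{p/N}(d ↔ b) ≥ 0`.  (Off `R` the glued block reaches no relay: `finger_noContact_reach_null` for `p/N`.)
[cite: KozmaNitzan2024, §3.2 pp. 12–14] -/
theorem T_finger_nonneg_of_X1 (p : Sym2 (Fin n) → unitInterval) (A N : Finset (Fin n)) (d b : Fin n)
    (hNA : Disjoint N A)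
    (hfree : ∀ v ∈ N, ∀ y : Fin n, y ∉ A → y ∉ N → (p s(v, y) : ℝ) = 0)
    (hX1 : (prodBernoulli (fun e' : Sym2 (Fin n) => if (∀ y ∈ e', y ∈ N) ∧ ¬ e'.IsDiag then 1 else p e')).real
        ({ω : Set (Sym2 (Fin n)) | ∃ v ∈ N, ∃ a ∈ A, s(v, a) ∈ ω} ∩ openConn d b) ≤
      (prodBernoulli (fun e' : Sym2 (Fin n) => if (∀ y ∈ e', y ∈ N) ∧ ¬ e'.IsDiag then 1 else p e')).real
        ({ω : Set (Sym2 (Fin n)) | ∃ v ∈ N, ∃ a ∈ A, s(v, a) ∈ ω} ∩ ⋃ v ∈ N, openConn v b)) :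
    0 ≤ (prodBernoulli (fun e' : Sym2 (Fin n) => if (∀ y ∈ e', y ∈ N) ∧ ¬ e'.IsDiag then 1 else p e')).real
          (⋃ v ∈ N, ⋃ a ∈ A, openConn v a)ᶜ +
        (prodBernoulli (fun e' : Sym2 (Fin n) => if (∀ y ∈ e', y ∈ N) ∧ ¬ e'.IsDiag then 1 else p e')).real
          (⋃ v ∈ N, openConn v b) -
        (prodBernoulli (fun e' : Sym2 (Fin n) => if (∀ y ∈ e', y ∈ N) ∧ ¬ e'.IsDiag then 1 else p e')).real
          (openConn d b) := by
  set μ := prodBernoulli (fun e' : Sym2 (Fin n) => if (∀ y ∈ e', y ∈ N) ∧ ¬ e'.IsDiag then 1 else p e') with hμ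
  set R : Set (Set (Sym2 (Fin n))) := {ω | ∃ v ∈ N, ∃ a ∈ A, s(v, a) ∈ ω} with hRdef
  have hmeas : ∀ s : Set (BondConfig (Fin n)), MeasurableSet s := fun _ => MeasurableSet.of_discrete
  -- the glued weighting still has relay-only pairs at `N`
  have hfree' : ∀ v ∈ N, ∀ y : Fin n, y ∉ A → y ∉ N →
      ((fun e' : Sym2 (Fin n) => if (∀ z ∈ e', z ∈ N) ∧ ¬ e'.IsDiag then 1 else p e') s(v, y) : ℝ) = 0 := by
    intro v hv y hyA hyN
    have hnot : ¬ ((∀ z ∈ s(v, y), z ∈ N) ∧ ¬ (s(v, y)).IsDiag) := by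
      rintro ⟨hall, -⟩
      exact hyN (hall y (Sym2.mem_mk_right v y))
    simp only [hnot, if_false]
    exact hfree v hv y hyA hyN
  have hnull : μ.real (Rᶜ ∩ ⋃ v ∈ N, ⋃ a ∈ A, openConn v a) = 0 :=
    finger_noContact_reach_null _ A N hNA hfree'
  -- split the three terms along `R`
  have h1 : μ.real (⋃ v ∈ N, ⋃ a ∈ A, openConn v a)ᶜ ≥ μ.real Rᶜ := by
    have hsplit := measureReal_inter_add_sdiff (μ := μ) (s := Rᶜ) (hmeas (⋃ v ∈ N, ⋃ a ∈ A, openConn v a))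
    have hsub : Rᶜ \ (⋃ v ∈ N, ⋃ a ∈ A, openConn v a) ⊆ (⋃ v ∈ N, ⋃ a ∈ A, openConn v a)ᶜ := fun ω hω => hω.2
    have := measureReal_mono (μ := μ) hsub (measure_ne_top _ _)
    linarith
  have h2 : μ.real (⋃ v ∈ N, openConn v b) ≥ μ.real (R ∩ ⋃ v ∈ N, openConn v b) :=
    measureReal_mono (μ := μ) Set.inter_subset_right (measure_ne_top _ _)
  have h3 : μ.real (openConn d b) ≤ μ.real (R ∩ openConn d b) + μ.real Rᶜ := by
    have hsplit := measureReal_inter_add_sdiff (μ := μ) (s := openConn d b) (hmeas R)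
    have hle : μ.real (openConn d b \ R) ≤ μ.real Rᶜ :=
      measureReal_mono (μ := μ) (fun ω hω => hω.2) (measure_ne_top _ _)
    rw [Set.inter_comm] at hsplit
    linarith
  linarith

/-- **`AdditiveGluing` for observers whose free neighbours are FINGERS, from the finger multi-edge Lemma 3 (FML3).**  If every non-relay
vertex `x ≠ o` with a positive-weight pair to `o` has positive-weight pairs only to `o` and to relays, and FML3 holds (hypothesis `hFML3`: for every
weighting, every non-empty block `N` disjoint from `A` with relay-only pairs and every `d ∈ A` minimising the UNGLUED two-point function, the
multi-edge Lemma-3 conclusion for the glued block), then for every `t ≥ 0` with `μ_w(a ↔ b) ≥ 1 − t` on `A`: `μ_w(o ↔ A) − t ≤ μ_w(o ↔ b)`.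
Kozma–Nitzan Thm 5 is the case of one finger (then no hypothesis is needed: `additiveGluing_block_of_oneFree`).
[cite: KozmaNitzan2024, Thm 5 (pp. 13–14), Lemma 3(i) (pp. 6–7), Question 9 (p. 36)] -/
theorem additiveGluing_fingers_of_FML3
    (hFML3 : ∀ (n : ℕ) (K : Sym2 (Fin n) → unitInterval) (A N : Finset (Fin n)) (d b : Fin n),
      b ∈ A → Disjoint N A → N.Nonempty → d ∈ A →
      (∀ v ∈ N, ∀ y : Fin n, y ∉ A → y ∉ N → (K s(v, y) : ℝ) = 0) →
      (∀ a ∈ A, (prodBernoulli K).real (openConn d b) ≤ (prodBernoulli K).real (openConn a b)) →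
      (prodBernoulli (fun e' : Sym2 (Fin n) => if (∀ y ∈ e', y ∈ N) ∧ ¬ e'.IsDiag then 1 else K e')).real
          ({ω : Set (Sym2 (Fin n)) | ∃ v ∈ N, ∃ a ∈ A, s(v, a) ∈ ω} ∩ openConn d b) ≤
        (prodBernoulli (fun e' : Sym2 (Fin n) => if (∀ y ∈ e', y ∈ N) ∧ ¬ e'.IsDiag then 1 else K e')).real
          ({ω : Set (Sym2 (Fin n)) | ∃ v ∈ N, ∃ a ∈ A, s(v, a) ∈ ω} ∩ ⋃ v ∈ N, openConn v b))
    (w : Sym2 (Fin n) → unitInterval) (A : Finset (Fin n)) (o b : Fin n) (hb : b ∈ A) (ho : o ∉ A)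
    (hfing : ∀ x : Fin n, x ∉ A → x ≠ o → (w s(o, x) : ℝ) ≠ 0 →
      ∀ y : Fin n, y ∉ A → y ≠ o → y ≠ x → (w s(x, y) : ℝ) = 0) :
    ∀ t : ℝ, 0 ≤ t →
      (∀ a ∈ A, 1 - t ≤ (prodBernoulli w).real (openConn a b)) →
      (prodBernoulli w).real (⋃ a ∈ A, openConn o a) - t ≤ (prodBernoulli w).real (openConn o b) := by
  intro t _ hA
  have hSA : Disjoint ({o} : Finset (Fin n)) A := Finset.disjoint_singleton_left.2 ho
  -- Question-9 designation of `o`: a minimiser of the star-killed two-point function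
  obtain ⟨e, he, hmin⟩ := Finset.exists_min_image A
    (fun a => (prodBernoulli (fun e' : Sym2 (Fin n) =>
      if (∃ y ∈ e', y ∈ ({o} : Finset (Fin n))) then (0 : unitInterval) else w e')).real (openConn a b)) ⟨b, hb⟩
  have hcert := T_block_certificate w A {o} e b hb hSA he hmin
  -- the free layers of positive mass are finger blocks, on which FML3 gives a non-negative bracket
  have hsum : 0 ≤ ∑ N ∈ (Finset.univ : Finset (Finset (Fin n))).filter (fun N => N.Nonempty ∧ Disjoint N A),
      (prodBernoulli (fun e' : Sym2 (Fin n) =>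
          if (∀ y ∈ e', y ∈ ({o} : Finset (Fin n))) ∧ ¬ e'.IsDiag then 1 else w e')).real
          {ω : BondConfig (Fin n) | ∀ y : Fin n, y ∈ N ↔ (y ∉ ({o} : Finset (Fin n)) ∧
            ∃ o' ∈ ({o} : Finset (Fin n)), s(o', y) ∈ ω)} *
        ((prodBernoulli (fun e' : Sym2 (Fin n) =>
            if (∀ y ∈ e', y ∈ N) ∧ ¬ e'.IsDiag then 1 else
              if (∃ y ∈ e', y ∈ ({o} : Finset (Fin n))) then 0 else w e')).real
            (⋃ v ∈ N, ⋃ a ∈ A, openConn v a)ᶜ +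
          (prodBernoulli (fun e' : Sym2 (Fin n) =>
            if (∀ y ∈ e', y ∈ N) ∧ ¬ e'.IsDiag then 1 else
              if (∃ y ∈ e', y ∈ ({o} : Finset (Fin n))) then 0 else w e')).real
            (⋃ v ∈ N, openConn v b) -
          (prodBernoulli (fun e' : Sym2 (Fin n) =>
            if (∀ y ∈ e', y ∈ N) ∧ ¬ e'.IsDiag then 1 else
              if (∃ y ∈ e', y ∈ ({o} : Finset (Fin n))) then 0 else w e')).real
            (openConn e b)) := by
    refine Finset.sum_nonneg fun N hN => ?_
    obtain ⟨hNne, hNA⟩ := (Finset.mem_filter.1 hN).2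
    by_cases hbad : ∃ y ∈ N, y = o ∨ (w s(o, y) : ℝ) = 0
    · -- a layer containing `o` itself or a non-neighbour of `o` has mass `0`
      obtain ⟨y, hyN, hy⟩ := hbad
      have hw0 : (prodBernoulli (fun e' : Sym2 (Fin n) =>
          if (∀ y ∈ e', y ∈ ({o} : Finset (Fin n))) ∧ ¬ e'.IsDiag then 1 else w e')).real
          {ω : BondConfig (Fin n) | ∀ y : Fin n, y ∈ N ↔ (y ∉ ({o} : Finset (Fin n)) ∧
            ∃ o' ∈ ({o} : Finset (Fin n)), s(o', y) ∈ ω)} = 0 := by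
        rcases hy with rfl | hy0
        · exact (T_layer_empty_of_mem {y} N y hyN (Finset.mem_singleton_self y)).symm ▸ measureReal_empty
        · by_cases hyo : y = o
          · subst hyo
            exact (T_layer_empty_of_mem {y} N y hyN (Finset.mem_singleton_self y)).symm ▸ measureReal_empty
          · refine T_layer_null w {o} N y hyN (by simpa using hyo) fun v hv => ?_
            rw [Finset.mem_singleton.1 hv]
            exact hy0
      rw [hw0, zero_mul]
    · -- all of `N` are fingers: apply FML3 in the star-killed weighting
      push Not at hbad
      refine mul_nonneg measureReal_nonneg ?_
      set K : Sym2 (Fin n) → unitInterval :=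
        fun e' => if (∃ y ∈ e', y ∈ ({o} : Finset (Fin n))) then (0 : unitInterval) else w e' with hK
      have hfreeK : ∀ v ∈ N, ∀ y : Fin n, y ∉ A → y ∉ N → (K s(v, y) : ℝ) = 0 := by
        intro v hv y hyA hyN
        by_cases hoy : ∃ z ∈ s(v, y), z ∈ ({o} : Finset (Fin n))
        · simp only [hK, hoy, if_true]
          rfl
        · simp only [hK, hoy, if_false]
          have hvo : v ≠ o := (hbad v hv).1
          have hyo : y ≠ o := fun h => hoy ⟨y, Sym2.mem_mk_right v y, Finset.mem_singleton.2 h⟩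
          have hvA : v ∉ A := Finset.disjoint_left.1 hNA hv
          have hyv : y ≠ v := fun h => hyN (h ▸ hv)
          exact hfing v hvA hvo (hbad v hv).2 y hyA hyo hyv
      have hX1 := hFML3 n K A N e b hb hNA hNne he hfreeK hmin
      exact T_finger_nonneg_of_X1 K A N e b hNA hfreeK hX1
  -- assemble: `T_e^{w}(o) ≥ 0`, then the additive inequality at level `t`
  have h1 : (prodBernoulli (fun e' : Sym2 (Fin n) =>
      if (∃ y ∈ e', y ∈ ({o} : Finset (Fin n))) then (0 : unitInterval) else w e')).real (openConn e b) ≤ 1 :=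
    measureReal_le_one
  have h2 : 0 ≤ (prodBernoulli (fun e' : Sym2 (Fin n) =>
          if (∀ y ∈ e', y ∈ ({o} : Finset (Fin n))) ∧ ¬ e'.IsDiag then 1 else w e')).real
          {ω : BondConfig (Fin n) | ∀ y : Fin n, y ∈ (∅ : Finset (Fin n)) ↔ (y ∉ ({o} : Finset (Fin n)) ∧
            ∃ o' ∈ ({o} : Finset (Fin n)), s(o', y) ∈ ω)} := measureReal_nonneg
  have hT : 0 ≤ (prodBernoulli (fun e' : Sym2 (Fin n) =>
          if (∀ y ∈ e', y ∈ ({o} : Finset (Fin n))) ∧ ¬ e'.IsDiag then 1 else w e')).real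
          (⋃ v ∈ ({o} : Finset (Fin n)), ⋃ a ∈ A, openConn v a)ᶜ +
        (prodBernoulli (fun e' : Sym2 (Fin n) =>
          if (∀ y ∈ e', y ∈ ({o} : Finset (Fin n))) ∧ ¬ e'.IsDiag then 1 else w e')).real
          (⋃ v ∈ ({o} : Finset (Fin n)), openConn v b) -
        (prodBernoulli (fun e' : Sym2 (Fin n) =>
          if (∀ y ∈ e', y ∈ ({o} : Finset (Fin n))) ∧ ¬ e'.IsDiag then 1 else w e')).real
          (openConn e b) := by
    nlinarith
  rw [goodStep24_glue_singleton w o] at hT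
  simp only [Finset.mem_singleton, Set.iUnion_iUnion_eq_left] at hT
  have hc : (prodBernoulli w).real (⋃ a ∈ A, openConn o a)ᶜ = 1 - (prodBernoulli w).real (⋃ a ∈ A, openConn o a) := by
    rw [measureReal_compl (MeasurableSet.of_discrete), probReal_univ]
  rw [hc] at hT
  -- `1 - t ≤ μ_w(e ↔ b)`
  have hAe := hA e he
  linarith

/-- Registered rung `stub_additiveGluingFingersOfFML3_vp` of crux stmt-CriticalPhenomena-4576 (depth prover png-dp-vplus): the finger class
of `AdditiveGluing` reduced to the finger multi-edge Lemma 3 (registered OPEN target `stub_fingerML3_vp`) — `additiveGluing_fingers_of_FML3`,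
closed statement. [cite: KozmaNitzan2024, Thm 5 (pp. 13–14), Lemma 3(i) (pp. 6–7)] -/
theorem stub_additiveGluingFingersOfFML3_vp : (∀ (n : ℕ) (K : Sym2 (Fin n) → unitInterval) (A N : Finset (Fin n)) (d b : Fin n), b ∈ A → Disjoint N A → N.Nonempty → d ∈ A → (∀ v ∈ N, ∀ y : Fin n, y ∉ A → y ∉ N → (K s(v, y) : ℝ) = 0) → (∀ a ∈ A, (Literature.Probability.LatticeModels.prodBernoulli K).real (Literature.Probability.Percolation.openConn d b) ≤ (Literature.Probability.LatticeModels.prodBernoulli K).real (Literature.Probability.Percolation.openConn a b)) → (Literature.Probability.LatticeModels.prodBernoulli (fun e' : Sym2 (Fin n) => if (∀ y ∈ e', y ∈ N) ∧ ¬ e'.IsDiag then 1 else K e')).real ({ω : Set (Sym2 (Fin n)) | ∃ v ∈ N, ∃ a ∈ A, s(v, a) ∈ ω} ∩ Literature.Probability.Percolation.openConn d b) ≤ (Literature.Probability.LatticeModels.prodBernoulli (fun e' : Sym2 (Fin n) => if (∀ y ∈ e', y ∈ N) ∧ ¬ e'.IsDiag then 1 else K e')).real ({ω : Set (Sym2 (Fin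 n)) | ∃ v ∈ N, ∃ a ∈ A, s(v, a) ∈ ω} ∩ ⋃ v ∈ N, Literature.Probability.Percolation.openConn v b)) → ∀ (n : ℕ) (w : Sym2 (Fin n) → unitInterval) (A : Finset (Fin n)) (o b : Fin n), b ∈ A → o ∉ A → (∀ x : Fin n, x ∉ A → x ≠ o → (w s(o, x) : ℝ) ≠ 0 → ∀ y : Fin n, y ∉ A → y ≠ o → y ≠ x → (w s(x, y) : ℝ) = 0) → ∀ t : ℝ, 0 ≤ t → (∀ a ∈ A, 1 - t ≤ (Literature.Probability.LatticeModels.prodBernoulli w).real (Literature.Probability.Percolation.openConn a b)) → (Literature.Probability.LatticeModels.prodBernoulli w).real (⋃ a ∈ A, Literature.Probability.Percolation.openConn o a) - t ≤ (Literature.Probability.LatticeModels.prodBernoulli w).real (Literature.Probability.Percolation.openConn o b) :=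
  fun hFML3 _ w A o b hb ho hfing => additiveGluing_fingers_of_FML3 hFML3 w A o b hb ho hfing

end TFingers

end

end Summit.CriticalPhenomena.PercolationContinuityZ3.Theorems
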